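/-
Origin: expansion seat `planner-pub-hodgecm-pv03-g7-0`, handover #4 2026-08-18T13:16:10Z (`HOME/pub-hodgecm-pv03-g7/lean/Pv03g7/GysinCM3.lean`, md5 d5dbdac9, 145 lines);
landed by the gen-8 packager in gate run 30 as `HodgeCM/Model/ToyG2/GysinCM3.lean` (import ^import Pv03g7\.Gysin3[ \t]*$→import HodgeCM.Model.ToyG2.Gysin3 ×1).
-/
/-
Copyright: pub-hodgecm cell (HodgeCMPerL). Consistency-witness layer (part (e)); FACTS.md §1c rows F7 / F7d.
Origin: HOME/pub-hodgecm-pv03-g7/lean/Pv03g7/GysinCM3.lean (WIP module `Pv03g7.GysinCM3`; intended final place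
`HodgeCM/Model/ToyG2/GysinCM3.lean` = module `HodgeCM.Model.ToyG2.GysinCM3`, CONTRIBUTING §3 kind L5)
(seat planner-pub-hodgecm-pv03-g7-0, DAG-node prover #03 gen 7).
WIP import to rewrite on landing: `import Pv03g7.Gysin3` ↦ `import HodgeCM.Model.ToyG2.Gysin3`.

# F7 / F7d / F2 transfer to a full sub-universe; F7 and F7d in the CM-good toy universe `toyUniverseCM d t`

`Universe.restrictObj Q hQ` (the full sub-universe of `U` on a constructor-closed class `Q` of varieties,
`HodgeCM/Model/ToyG2/Restrict.lean`) has the cohomology, pull-backs, cup products, traces and algebraic classes of `U`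
definitionally, but its iterated products `prodFin` / factor projections `prj` agree with those of `U` only
propositionally (`prodFin_restrictObj_val`) resp. up to `HEq`.  Exactly as for the morphism restriction `U.restrict C`
(`HodgeCM/Model/Toy/CMInflationIndependentBlocks.lean`, whose `HEq` toolkit and block-datum restatement
`fact_gysin_iff_blockBody` / `blockBody_congr` are reused verbatim), F7 `Fact_gysin`, F7d `Fact_gysinDescent` and
F2 `Fact_factorActDescends` therefore transfer from `U` to `U.restrictObj Q hQ`:

* `Universe.restrictObj_prj_heq`, `Universe.restrictObj_prjPull_heq`, `Universe.restrictObj_prjPull_heq₁` — the factor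
  projections and their pull-back families of the sub-universe are those of `U`, up to `HEq`;
* `Universe.restrictObj_fact_gysin`, `Universe.restrictObj_fact_gysinDescent`, `Universe.restrictObj_fact_factorActDescends`
  — F7, F7d and F2 transfer (any `U`, any `Q`; for F2 with NO condition on the class, unlike the morphism restriction);
* `HodgeCM.ToyG2.toyUniverseCM_fact_gysin (d t) : (toyUniverseCM d t).Fact_gysin` — F7 holds, unconditionally, in the
  CM-good toy universe of `HodgeCM/Model/ToyG2/G4WitnessCM.lean` (from `toyUniverse₃_fact_gysin`, `Gysin3.lean`);
* `HodgeCM.ToyG2.toyUniverse₃_fact_gysinDescent_all (d t)`, `HodgeCM.ToyG2.toyUniverseCM_fact_gysinDescent (d t)` — F7d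
  holds, unconditionally, in `toyUniverse₃ d t` (toy-g3's `fact3_gysinDescent` at the model axioms
  `toyUniverse₃_modelAxioms_all`, `DescentFacts3.lean` / `TrTopAll3.lean`) and hence in `toyUniverseCM d t`.

KERNEL only: cites nothing, posits nothing, no hypotheses.
-/
import Mathlib
import Summits.HodgeConjecture.HodgeCM.Model.ToyG2.Gysin3_2
import Summits.HodgeConjecture.HodgeCM.Model.ToyG2.Restrict
import Summits.HodgeConjecture.HodgeCM.Model.ToyG2.G4WitnessCM
import Summits.HodgeConjecture.HodgeCM.Model.Toy.CMInflationIndependentBlocks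
import Summits.HodgeConjecture.HodgeCM.Model.ToyG2.DescentFacts3_2
import Summits.HodgeConjecture.HodgeCM.Model.ToyG2.TrTopAll3

/-! PORT of `HodgeCM/Model/ToyG2/GysinCM3.lean` (HodgeCMPerL run 82) — verbatim mechanical port; provenance in the PORT header line. -/

noncomputable section

namespace HodgeCM

namespace Universe

variable (U : Universe) {Q : U.Var → Prop} (hQ : U.SubClosed Q)

/-- The factor projections of the full sub-universe `U.restrictObj Q hQ` are those of `U`, up to
`prodFin_restrictObj_val`. -/
theorem restrictObj_prj_heq (n : ℕ) (X : Fin (n + 1) → (U.restrictObj Q hQ).Var) (j : Fin (n + 1)) :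
    HEq ((U.restrictObj Q hQ).prj n X j) (U.prj n (fun j => (X j).1) j) := by
  induction n with
  | zero =>
    cases j using Fin.lastCases with
    | last => simp only [prj, Fin.lastCases_last]; exact HEq.rfl
    | cast i => exact i.elim0
  | succ n ih =>
    cases j using Fin.lastCases with
    | last =>
      simp only [prj, Fin.lastCases_last]
      exact U.heq_snd_of_eq (prodFin_restrictObj_val hQ n _) _
    | cast i =>
      simp only [prj, Fin.lastCases_castSucc]
      exact U.heq_comp_fst_of_heq (prodFin_restrictObj_val hQ n _) _ (ih _ i)

/-- all-degree pull-back families of (re-indexed) factor projections: `U.restrictObj Q hQ` versus `U` -/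
theorem restrictObj_prjPull_heq (n : ℕ) (X : Fin (n + 1) → (U.restrictObj Q hQ).Var) {ι : Type}
    (σ : ι → Fin (n + 1)) :
    HEq (fun i k => (U.restrictObj Q hQ).pull ((U.restrictObj Q hQ).prj n X (σ i)) k)
      (fun i k => U.pull (U.prj n (fun j => (X j).1) (σ i)) k) :=
  U.heq_pullFamily (fun i => (X (σ i)).1) (prodFin_restrictObj_val hQ n X)
    (fun i => (U.restrictObj Q hQ).prj n X (σ i)) (fun i => U.prj n (fun j => (X j).1) (σ i))
    (fun i => U.restrictObj_prj_heq hQ n X (σ i))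

/-- the same in one degree -/
theorem restrictObj_prjPull_heq₁ (n : ℕ) (X : Fin (n + 1) → (U.restrictObj Q hQ).Var) (k : ℕ) :
    HEq (fun i => (U.restrictObj Q hQ).pull ((U.restrictObj Q hQ).prj n X i) k)
      (fun i => U.pull (U.prj n (fun j => (X j).1) i) k) :=
  U.heq_pullFamily₁ (fun i => (X i).1) (prodFin_restrictObj_val hQ n X)
    (fun i => (U.restrictObj Q hQ).prj n X i) (fun i => U.prj n (fun j => (X j).1) i)
    (fun i => U.restrictObj_prj_heq hQ n X i) k

/-- **F7 transfers to a full sub-universe.** -/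
theorem restrictObj_fact_gysin (h : U.Fact_gysin) : (U.restrictObj Q hQ).Fact_gysin := by
  rw [fact_gysin_iff_blockBody] at h ⊢
  intro F n m Ξ
  exact (U.blockBody_congr (cmProd_restrictObj_val hQ F Ξ).symm (cmProd_restrictObj_val hQ F (blkA Ξ)).symm
    (cmProd_restrictObj_val hQ F (blkB Ξ)).symm
    (U.restrictObj_prjPull_heq hQ n (fun j => (U.restrictObj Q hQ).cmAV F (blkA Ξ j)) id).symm
    (U.restrictObj_prjPull_heq hQ (n + 1 + m) (fun k => (U.restrictObj Q hQ).cmAV F (Ξ k)) (Fin.castAdd (m + 1))).symm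
    (U.restrictObj_prjPull_heq hQ m (fun i => (U.restrictObj Q hQ).cmAV F (blkB Ξ i)) id).symm
    (U.restrictObj_prjPull_heq hQ (n + 1 + m) (fun k => (U.restrictObj Q hQ).cmAV F (Ξ k))
      (fun i : Fin (m + 1) => Fin.natAdd (n + 1) i)).symm
    (U.phiGysin_heq (cmProd_restrictObj_val hQ F Ξ).symm (cmProd_restrictObj_val hQ F (blkA Ξ)).symm
      (cmProd_restrictObj_val hQ F (blkB Ξ)).symm)).mp (h F n m Ξ)

/-- **F7d transfers to a full sub-universe.** -/
theorem restrictObj_fact_gysinDescent (h : U.Fact_gysinDescent) : (U.restrictObj Q hQ).Fact_gysinDescent := by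
  rw [fact_gysinDescent_iff_blockBody] at h ⊢
  intro F n m Ξ
  exact (U.blockBody_congr (cmProd_restrictObj_val hQ F Ξ).symm (cmProd_restrictObj_val hQ F (blkA Ξ)).symm
    (cmProd_restrictObj_val hQ F (blkB Ξ)).symm
    (U.restrictObj_prjPull_heq hQ n (fun j => (U.restrictObj Q hQ).cmAV F (blkA Ξ j)) id).symm
    (U.restrictObj_prjPull_heq hQ (n + 1 + m) (fun k => (U.restrictObj Q hQ).cmAV F (Ξ k)) (Fin.castAdd (m + 1))).symm
    (U.restrictObj_prjPull_heq hQ m (fun i => (U.restrictObj Q hQ).cmAV F (blkB Ξ i)) id).symm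
    (U.restrictObj_prjPull_heq hQ (n + 1 + m) (fun k => (U.restrictObj Q hQ).cmAV F (Ξ k))
      (fun i : Fin (m + 1) => Fin.natAdd (n + 1) i)).symm
    (U.phiDescent_heq (cmProd_restrictObj_val hQ F Ξ).symm (cmProd_restrictObj_val hQ F (blkA Ξ)).symm
      (cmProd_restrictObj_val hQ F (blkB Ξ)).symm)).mp (h F n m Ξ)

/-- **F2 transfers to a full sub-universe** (no condition on the class: a full sub-universe keeps every morphism,
in particular the descended factor actions). -/
theorem restrictObj_fact_factorActDescends (h : U.Fact_factorActDescends) :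
    (U.restrictObj Q hQ).Fact_factorActDescends := by
  rw [fact_factorActDescends_iff_f2Body] at h ⊢
  intro F n m Ξ
  exact (U.f2Body_congr F Ξ (cmProd_restrictObj_val hQ F Ξ).symm (cmProd_restrictObj_val hQ F (blkA Ξ)).symm
    (cmProd_restrictObj_val hQ F (blkB Ξ)).symm
    (U.restrictObj_prjPull_heq hQ n (fun j => (U.restrictObj Q hQ).cmAV F (blkA Ξ j)) id).symm
    (U.restrictObj_prjPull_heq hQ (n + 1 + m) (fun k => (U.restrictObj Q hQ).cmAV F (Ξ k)) (Fin.castAdd (m + 1))).symm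
    (U.restrictObj_prjPull_heq hQ m (fun i => (U.restrictObj Q hQ).cmAV F (blkB Ξ i)) id).symm
    (U.restrictObj_prjPull_heq hQ (n + 1 + m) (fun k => (U.restrictObj Q hQ).cmAV F (Ξ k))
      (fun i : Fin (m + 1) => Fin.natAdd (n + 1) i)).symm
    (U.restrictObj_prjPull_heq₁ hQ (n + 1 + m) (fun k => (U.restrictObj Q hQ).cmAV F (Ξ k)) 1).symm
    (U.restrictObj_prjPull_heq₁ hQ n (fun j => (U.restrictObj Q hQ).cmAV F (blkA Ξ j)) 1).symm
    (U.restrictObj_prjPull_heq₁ hQ m (fun i => (U.restrictObj Q hQ).cmAV F (blkB Ξ i)) 1).symm).mp (h F n m Ξ)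

end Universe

namespace ToyG2

/-- **F7 `Fact_gysin` holds in the CM-good toy universe `toyUniverseCM d t`** (no hypotheses). -/
theorem toyUniverseCM_fact_gysin (d t : ℚ) : (toyUniverseCM d t).Fact_gysin :=
  (toyUniverse₃ d t).restrictObj_fact_gysin (isCM_subClosed d t) (toyUniverse₃_fact_gysin d t)

/-- F7d `Fact_gysinDescent` holds in `toyUniverse₃ d t` (no hypotheses: toy-g3's `fact3_gysinDescent` at
`toyUniverse₃_modelAxioms_all`). -/
theorem toyUniverse₃_fact_gysinDescent_all (d t : ℚ) : (toyUniverse₃ d t).Fact_gysinDescent :=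
  fact3_gysinDescent traceSys (gplOf d t) (toyUniverse₃_modelAxioms_all d t)

/-- **F7d `Fact_gysinDescent` holds in the CM-good toy universe `toyUniverseCM d t`** (no hypotheses). -/
theorem toyUniverseCM_fact_gysinDescent (d t : ℚ) : (toyUniverseCM d t).Fact_gysinDescent :=
  (toyUniverse₃ d t).restrictObj_fact_gysinDescent (isCM_subClosed d t) (toyUniverse₃_fact_gysinDescent_all d t)

end ToyG2

end HodgeCM
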